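import Literature.NumberTheory.EllipticCurves.Kato2004.UniversalNormsIntegralProofs
import Literature.NumberTheory.EllipticCurves.Kato2004.IwasawaCohomologyCoeffNewform
import HarnessLib

/-!
# `stub_cmLambdaLower` — stub-ideation k3 (gen 9): the S₀-INTEGRALITY of the S4 Poitou–Tate port is
# Kato's Lemma 8.5 (2) for the newform lattice `T_ρ` (a PROVED tree theorem for `T_pW`), not purity

Crux stmt-BirchSwinnertonDyer-26074 (`ResidualThetaCountLowerPureAtTwo`), registered skeleton
`Cruxes/ResidualThetaCountLowerPureAtTwo/Lines/bt26_lambda.lean` (v6), stub `stub_cmLambdaLower`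
(= route item stmt-BirchSwinnertonDyer-22608 `ResidualSignedLambdaLowerCMAtTwo`, FIXED, cited BY NAME,
never re-typed here).  TECHNIQUE = decomposition (split into sub-stubs with a provable glue).

THE CUT (inside the critic's S4λ / the lead's S4rel = relaxed deep half):
* `S4rel` («every (z, χ) ⊥ SelRel is, up to a ≠ 0, the local datum of a class of Kato's 𝐇¹ = I.H»)
  ⟸ `S4rel♭` (the SAME Poitou–Tate + Kőnig port, but concluding in a BARE cores-compatible family
  `y : ∀ n, H¹(ℚ_n, T_ρ)` — no `integralH1` clause, no `I.H`, no purity, no (I)/(I)_bad bricks)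
  + `UN_ρ` (Kato Lemma 8.5 (2) = Rubin B.3.3 = Perrin-Riou 2.2.4 for `T_ρ` along the cyclotomic
  `ℤ₂`-tower: cores-compatible ⟹ integral at EVERY v ≠ 2, slack a₀ = 1)
  with the glue `deepHalf_of_flat` PROVED below (H6) and LOSSLESS (H7: the converse holds too).
* `UN_ρ` (H1 at `T := ρ.toGaloisRep`, H8) is the ρ-twin of the tree THEOREM
  `Kato2004.UniversalNorms.mem_integralH1_of_layerCores_eq` (file `UniversalNormsIntegralProofs.lean`,
  weight-free, Weil/Deligne-free, BV-free; H9 records the W-instance by name) — an M-sized generic port.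

Helper signatures H1–H9 below all elaborate; 0 `sorry`.  BSD is NOT proved by any of this: these are
typing aids for ONE registered stub of ONE line on ONE crux of the route `ResidualThetaTransportAtTwo`.
-/

noncomputable section

open scoped NumberField
open Field IsDedekindDomain CongruenceSubgroup
open Literature.NumberTheory.GaloisRepresentations
open Literature.NumberTheory.EllipticCurves Literature.NumberTheory.EllipticCurves.ModularForms
open Literature.NumberTheory.EllipticCurves.ZpExtension
open Literature.NumberTheory.EllipticCurves.Kato2004
open Literature.NumberTheory.EllipticCurves.Kato2004.EulerSystemValues
open scoped Padic

namespace Summit.BirchSwinnertonDyer.BirchSwinnertonDyer.Cruxes.ResidualThetaCountLowerPureAtTwo.StubIdeasK3G9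

section Generic

variable {A : Type} [CommRing A] [TopologicalSpace A] {M : Type} [AddCommGroup M] [Module A M]
  [TopologicalSpace M] [IsTopologicalAddGroup M] [ContinuousSMul A M]

/-- **H1 (`UN`, the helper LEMMA of the cut — Kato 2004 Lemma 8.5 (2), general coefficient form = the
`TODO(general form)` of the tree's named fact `Kato2004.mem_integralH1_of_forall_layerCores_eq`).**
For a continuous representation `T` of `Γ_ℚ` with coefficients `A` and the cyclotomic `ℤ_p`-extension
`κ`: every cores-compatible family `z_n ∈ H¹(ℚ_n, T)` consists of INTEGRAL classes
(`z_n ∈ H¹(ℤ_n[1/p], T) = Kato2004.integralH1`, i.e. unramified at every `v ≠ p`).  Slack-free (a₀ = 1),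
purity-free.  For `T = tateRep W p` this is the tree theorem of H9.
[cite: Kato2004Asterisque, Lemma 8.5 (2) (p. 183)] [cite: Rubin2000, App. B Prop. B.3.3] -/
def UniversalNormsIntegral (T : GaloisRep ℚ A M) (p : ℕ) [Fact p.Prime] (κ : ZpExtension ℚ p) : Prop :=
  κ.IsCyclotomic → ∀ z : (∀ n : ℕ, H1 T (κ.layerSubgroup n)),
    (∀ n, layerCores T κ n (z (n + 1)) = z n) → ∀ n, z n ∈ integralH1 T p (κ.layerSubgroup n)

variable {T : GaloisRep ℚ A M} {p : ℕ} [Fact p.Prime] {κ : ZpExtension ℚ p}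
  {γ : absoluteGaloisGroup ℚ}

/-- **H2.** Under H1 the integrality clause of `Kato2004.IsNormCompatible` is REDUNDANT: a family is a
norm-compatible integral family iff it is cores-compatible. -/
theorem isNormCompatible_iff_layerCores (h : UniversalNormsIntegral T p κ) (hκ : κ.IsCyclotomic)
    (y : ∀ n : ℕ, H1 T (κ.layerSubgroup n)) :
    IsNormCompatible T κ y ↔ ∀ n, layerCores T κ n (y (n + 1)) = y n :=
  ⟨fun hy => hy.2, fun hy => ⟨h hκ y hy, hy⟩⟩

/-- **H3′.** `x ↦ (proj n x)_n` is injective on Kato's `𝐇¹` (no H1 needed; `proj_injective`). -/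
theorem toFamily_injective (I : IwasawaH1DataCoeff T p κ γ) : Function.Injective I.toFamily := by
  intro x x' hxx'
  have h0 : x - x' = 0 := I.proj_injective _ fun n => by
    rw [map_sub, I.toFamily_apply_eq, I.toFamily_apply_eq, hxx', sub_self]
  exact sub_eq_zero.mp h0

/-- **H3 (the ∃!-transport of the glue).** Under H1, every cores-compatible family `y` is the projection
family of a UNIQUE element of Kato's `𝐇¹ = I.H` (`proj_surjective` fed by H1, `proj_injective`). -/
theorem existsUnique_proj_eq (I : IwasawaH1DataCoeff T p κ γ) (h : UniversalNormsIntegral T p κ)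
    (hκ : κ.IsCyclotomic) (y : ∀ n : ℕ, H1 T (κ.layerSubgroup n))
    (hy : ∀ n, layerCores T κ n (y (n + 1)) = y n) : ∃! x : I.H, ∀ n, I.proj n x = y n := by
  obtain ⟨x, hx⟩ := I.proj_surjective y ⟨h hκ y hy, hy⟩
  refine ⟨x, hx, fun x' hx' => ?_⟩
  have h0 : x' - x = 0 := I.proj_injective _ fun n => by rw [map_sub, hx n, hx' n, sub_self]
  exact sub_eq_zero.mp h0

/-- **H4 (currency form, PLAN 2).** Under H1, `𝐇¹ → ∏_n H¹(ℚ_n, T)` is a bijection onto the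
CORES-COMPATIBLE families: `𝐇¹ = lim←_n H¹(ℚ_n, T)` (full cohomology, no `ℤ_n[1/p]`). -/
theorem range_toFamily_eq (I : IwasawaH1DataCoeff T p κ γ) (h : UniversalNormsIntegral T p κ)
    (hκ : κ.IsCyclotomic) :
    Set.range I.toFamily = {y | ∀ n, layerCores T κ n (y (n + 1)) = y n} := by
  ext y
  constructor
  · rintro ⟨x, rfl⟩ n
    exact I.cores_proj n x
  · intro hy
    obtain ⟨x, hx, -⟩ := existsUnique_proj_eq I h hκ y hy
    exact ⟨x, funext hx⟩

/-! ### The cut `S4rel ⟸ S4rel♭ + UN` over an ABSTRACT local-value map `Φ` (the lead's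
`(locd₂, locd_S)` read on level families — by C3 of SKELETON-V2-CUT-g16 they ARE defined levelwise
through `I.proj n`), target set `Ann` (the data ⊥ SelRel) and slack in `A`. -/

variable {V : Type*} [SMul A V]

/-- **S4rel♭ (flat relaxed deep half — the PT-core sub-stub's SHAPE).** Every target `t ∈ Ann` is, up
to a slack `a ≠ 0`, the value `Φ y` of a CORES-COMPATIBLE family `y` — nothing said about ramification
of the `y_n` at `v ≠ p`. -/
def DeepHalfFlat (T : GaloisRep ℚ A M) (κ : ZpExtension ℚ p)
    (Φ : (∀ n : ℕ, H1 T (κ.layerSubgroup n)) → V) (Ann : Set V) : Prop :=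
  ∀ t ∈ Ann, ∃ a : A, a ≠ 0 ∧ ∃ y : (∀ n : ℕ, H1 T (κ.layerSubgroup n)),
    (∀ n, layerCores T κ n (y (n + 1)) = y n) ∧ a • t = Φ y

/-- **S4rel (relaxed deep half, the lead's shape): witnesses in Kato's `𝐇¹ = I.H`.** -/
def DeepHalf (I : IwasawaH1DataCoeff T p κ γ)
    (Φ : (∀ n : ℕ, H1 T (κ.layerSubgroup n)) → V) (Ann : Set V) : Prop :=
  ∀ t ∈ Ann, ∃ a : A, a ≠ 0 ∧ ∃ x : I.H, a • t = Φ (I.toFamily x)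

/-- **H6 (THE GLUE of the cut, proved): `S4rel♭ → UN → S4rel`.** -/
theorem deepHalf_of_flat (I : IwasawaH1DataCoeff T p κ γ) (h : UniversalNormsIntegral T p κ)
    (hκ : κ.IsCyclotomic) {Φ : (∀ n : ℕ, H1 T (κ.layerSubgroup n)) → V} {Ann : Set V}
    (hflat : DeepHalfFlat T κ Φ Ann) : DeepHalf I Φ Ann := by
  intro t ht
  obtain ⟨a, ha, y, hy, hval⟩ := hflat t ht
  obtain ⟨x, hx, -⟩ := existsUnique_proj_eq I h hκ y hy
  refine ⟨a, ha, x, ?_⟩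
  have hxy : I.toFamily x = y := funext hx
  rw [hxy]
  exact hval

/-- **H7 (the cut is LOSSLESS): `S4rel → S4rel♭`** (by `cores_proj`; no H1 needed). -/
theorem flat_of_deepHalf (I : IwasawaH1DataCoeff T p κ γ)
    {Φ : (∀ n : ℕ, H1 T (κ.layerSubgroup n)) → V} {Ann : Set V} (hdeep : DeepHalf I Φ Ann) :
    DeepHalfFlat T κ Φ Ann := by
  intro t ht
  obtain ⟨a, ha, x, hval⟩ := hdeep t ht
  exact ⟨a, ha, I.toFamily x, fun n => I.cores_proj n x, hval⟩

/-- **H6 + H7.** Under `UN`, the lead's S4rel and the flat S4rel♭ are EQUIVALENT. -/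
theorem deepHalf_iff_flat (I : IwasawaH1DataCoeff T p κ γ) (h : UniversalNormsIntegral T p κ)
    (hκ : κ.IsCyclotomic) {Φ : (∀ n : ℕ, H1 T (κ.layerSubgroup n)) → V} {Ann : Set V} :
    DeepHalf I Φ Ann ↔ DeepHalfFlat T κ Φ Ann :=
  ⟨flat_of_deepHalf I, deepHalf_of_flat I h hκ⟩

end Generic

/-- **H8 (`UN_ρ`, the SUB-STUB = PLAN 1's deliverable, signature).** Kato Lemma 8.5 (2) for the lattice
`T_ρ = ρ.toGaloisRep` of an integral `p`-adic model of a weight-2 cusp form along `ι` — NO arithmetic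
hypothesis on `ρ` is needed (Lemma 8.5 (2) holds for every finitely generated `ℤ_p`-`T` with continuous
`Γ_ℚ`-action); `p = 2` included.  To be landed as the generic port of `UniversalNormsIntegralProofs.lean`
(`Literature/…/Kato2004/`), then cited BY NAME inside `S4rel`'s proof.
[cite: Kato2004Asterisque, Lemma 8.5 (2) (p. 183)] [cite: Rubin2000, App. B Prop. B.3.3] -/
def UniversalNormsIntegralNewform : Prop :=
  ∀ (p : ℕ) [Fact p.Prime] (M : ℕ) [NeZero M] (g : CuspForm (Gamma0 M) 2)
    (ι : coeffField g →+* PadicAlgCl p)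
    (ρ : FramedGaloisRep ℚ (padicCoeffIntegers (Set.range ι)) 2) (κ : ZpExtension ℚ p),
    UniversalNormsIntegral ρ.toGaloisRep p κ

/-- **H9 (PRECEDENT, kernel-checked): the `T_pW`-instance of H1 IS the tree theorem**
`Kato2004.UniversalNorms.mem_integralH1_of_layerCores_eq` (any elliptic `W/ℚ`, any `p`, `p = 2`
included) — the port H8 replaces `tateRep W p` by `ρ.toGaloisRep` in that file and its three inputs. -/
theorem universalNormsIntegral_tateRep (W : WeierstrassCurve ℚ) [W.IsElliptic] (p : ℕ) [Fact p.Prime]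
    [ContinuousSMul ℤ_[p] (W.tateModule p)] (κ : ZpExtension ℚ p) :
    UniversalNormsIntegral (tateRep W p) p κ :=
  fun hκ z hz n => UniversalNorms.mem_integralH1_of_layerCores_eq W p κ hκ z hz n

/-- **H5 (budget collapse, recorded as a one-liner): under `UN` the critic's integrality slack
`(κ) : ∃ a₀ ≠ 0, ∀ y cores-compatible, ∀ n, a₀ • y n ∈ integralH1` holds with `a₀ = 1`.** -/
theorem slack_one_of_universalNorms {A : Type} [CommRing A] [TopologicalSpace A] {M : Type}
    [AddCommGroup M] [Module A M] [TopologicalSpace M] [IsTopologicalAddGroup M] [ContinuousSMul A M]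
    {T : GaloisRep ℚ A M} {p : ℕ} [Fact p.Prime] {κ : ZpExtension ℚ p}
    (h : UniversalNormsIntegral T p κ) (hκ : κ.IsCyclotomic)
    (y : ∀ n : ℕ, H1 T (κ.layerSubgroup n)) (hy : ∀ n, layerCores T κ n (y (n + 1)) = y n) (n : ℕ) :
    (1 : A) • y n ∈ integralH1 T p (κ.layerSubgroup n) := by
  rw [one_smul]
  exact h hκ y hy n

end Summit.BirchSwinnertonDyer.BirchSwinnertonDyer.Cruxes.ResidualThetaCountLowerPureAtTwo.StubIdeasK3G9

end
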